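import Summits.SmoothPoincare4.SmoothPoincare4.Theses.SymplecticOrigami
import Summits.SmoothPoincare4.SmoothPoincare4.Theorems.SymplecticOrigamiNoGenusTwoDoorStubTaubesCanonicalCurveDoorLattice
import Literature.Geometry.Symplectic.MinimalSymplecticFourBPlusOne
import Literature.Topology.FourManifolds.ComplexProjectiveSpaceHomologyProofs
import Literature.Topology.FourManifolds.SphereProductCohomology
import Literature.AlgebraicTopology.SingularHomology.EulerCharacteristicTriple
import HarnessLib

/-!
# `NoGenusTwoDoor` ⟸ Gompf's question (non-negative Euler characteristic of non-ruled symplectic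
`4`-manifolds) — crux stmt-SmoothPoincare4-7842, route `SymplecticOrigami`

The crux D = `NoGenusTwoDoor` says that no closed connected symplectic `4`-manifold `(N, s)` has
`(rank H₁(N; ℤ), rank H₂(N; ℤ)) = (2, 1)` (a DOOR).  This file proves, sorry-free, that D is a
COROLLARY of the affirmative answer to Gompf's 1995 question — "whether a non-ruled symplectic
`4`-manifold necessarily has non-negative Euler characteristic" (Kotschick, PAMS 134 (2006),
p. 3 of arXiv:math/0504578: "This question is still open"; T.-J. Li, *Kodaira dimension in low
dimensional topology*, arXiv:1511.04831, §4.3.1, Conj. 4.9 for `κˢ = 1` and Conj. 4.11 (BMY) for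
`κˢ = 2`) — in the MINIMAL, KODAIRA form the tree can type: for every closed connected
symplectic `(N, s)` that is minimal (no symplectic `(-1)`-sphere, `IsMinimal`) and has
`K · [ω] ≥ 0` (equivalently, by Liu 1996 Thm. B / Ohta–Ono 1996 — McDuff–Salamon 2017
Rem. 13.3.28 (ii) — is neither rational nor ruled), `χ(N) ≥ 0`.  The hypothesis is taken
STRUCTURALLY (`hG` below spells the statement out), so this file depends on no conjecture `def`;
the registered Literature statement `GompfEulerCharacteristicQuestion` (proposed alongside) is
this Pi-type verbatim.

Main results (namespace `…Theorems.NoGenusTwoDoor.GompfBridge`):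

* `isMinimal_of_door` — a door is minimal: with `b₂ = 1` and `b⁺ ≥ 1` the intersection form of
  the symplectic orientation is `Q(x, y) = e(x) e(y)` (`exists_linearEquiv_intersectionForm_of_door`,
  p-landed helper of the line `canonical-cap-filling`), so no class has square `-1`;
* `not_nonempty_diffeomorph_complexProjectivePlane_of_door` — a door is not `ℂP²`
  (`H₁(ℂP²; ℤ) = 0`, the tree's proved `singularHomology_complexProjectiveSpace_holds`, versus
  `rank H₁(N; ℤ) = 2`);
* `canonicalClassDotOmega_nonneg_of_door` — `K · [ω] ≥ 0` for a door, from Liu's `b₂ = 1` theorem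
  (`liu1996_complexProjectivePlane_of_rank_two_eq_one`: `b₂ = 1 ∧ K · [ω] < 0 ⇒ N ≅ ℂP²`);
* `noGenusTwoDoor_of_eulerChar_nonneg` — **Gompf's question (minimal Kodaira form) ⇒ D**, modulo
  the two printed named facts `one_le_bPlus` (McDuff–Salamon 2017 Rem. 13.3.4: `b⁺ ≥ 1` for the
  symplectic orientation) and `liu1996_complexProjectivePlane_of_rank_two_eq_one` (Liu 1996,
  proof of Thm. B): a door is minimal, has `K · [ω] ≥ 0` and `χ = -1 < 0`.

So the honest shape of the route is `SmoothPoincare4 ⟸ OrigamiRung ∧ OrigamiFoldExistence ∧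
(Gompf's question at b⁺ = 1)`; T.-J. Li (loc. cit. §4.3.1) records that a `b⁺ = 1` manifold with
`χ < 0` and `κˢ ≥ 0` "must have `b₁ = 2` … `χ = -1` and `σ = 1` … `K_ω · K_ω = 1` … hence minimal,
such a manifold has `κˢ = 2`" — i.e. is exactly a door.

MIGRATION 2026-08-17 (lead c10, after p160979 retyped `bPlus` / `IsSymplecticSphere` /
`canonicalClassSq` / `canonicalClassDotOmega` over `calibratedSymplecticOrientation s hs hnd` and PROVED
`one_le_bPlus_holds`): `isMinimal_of_door` is now orientation-agnostic (helper
`not_sphere_sq_neg_one_of_door` over an arbitrary `ℤ`-orientation `μ` with `b⁺(μ) ≥ 1`; the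
orientation inside `bPlus` / `IsSymplecticSphere` is picked up by unification, so the file no longer
depends on the body of those definitions); all other declarations, names and signatures are
unchanged.  The hypotheses `(h1 : one_le_bPlus)` (now a theorem of the tree, `one_le_bPlus_holds`) and
`(hL : liu1996_complexProjectivePlane_of_rank_two_eq_one)` (Liu's `b₂ = 1` statement in the tree's raw
Chern sign) are DEPRECATED AS HYPOTHESES; they are kept here verbatim because the registered stub
`stub_noGenusTwoDoor_of_gompfQuestion` and `Theorems/GompfEulerCharacteristicQuestion.lean` name them
(ledger-referenced signatures), with `linter.deprecated` switched off on exactly the four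
declarations that must name them.  The choice-free, sign-calibrated successor of this bridge is
`Theorems/SymplecticOrigamiNoGenusTwoDoorCalibratedBridge.lean` (p162069).

Sources: D. Kotschick, PAMS 134 (2006) 3081–3083 (arXiv:math/0504578), p. 3; T.-J. Li,
arXiv:1511.04831 (2015), §4.3.1, Conj. 4.9, Conj. 4.11; A.-K. Liu, MRL 3 (1996) 569–585, Thm. B
and pp. 578–579; D. McDuff, D. Salamon, *Introduction to Symplectic Topology* (2017), Rem. 13.3.4,
Rem. 13.3.28 (ii); A. Hatcher, *Algebraic Topology* (2002), Thm. 2.35 (iii), Thm. 3.30.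
-/

noncomputable section

-- the prescribed namespace `Summit.<P>.<Sub>.…` duplicates `SmoothPoincare4` (P = Sub)
set_option linter.dupNamespace false

open scoped Manifold ContDiff Topology ContinuousMap
open Set Function TopologicalSpace CategoryTheory Limits
open Literature.Geometry.Kaehler (MForm IsSmoothForm IsClosedForm)
open Literature.AlgebraicTopology.SingularHomology
open Literature.Topology.FourManifolds (singularHomologyZ ComplexProjectivePlane ComplexProjectiveSpace)
open Literature.Geometry.Symplectic
open Summit.SmoothPoincare4.SmoothPoincare4.Theses.SymplecticOrigami (NoGenusTwoDoor)
open Summit.SmoothPoincare4.SmoothPoincare4.Theorems.NoGenusTwoDoor.CanonicalCapFilling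
  (exists_linearEquiv_intersectionForm_of_door relEuler_eq_neg_one_of_door)

namespace Summit.SmoothPoincare4.SmoothPoincare4.Theorems.NoGenusTwoDoor.GompfBridge

section Door

variable {N : Type} [TopologicalSpace N] [T2Space N] [SecondCountableTopology N] [CompactSpace N]
  [ConnectedSpace N] [ChartedSpace (EuclideanSpace ℝ (Fin 4)) N] [IsManifold (𝓡 4) ∞ N]

omit [SecondCountableTopology N] [ConnectedSpace N] [IsManifold (𝓡 4) ∞ N] in
/-- **No `(-1)`-class on a door, for any orientation with `b⁺ ≥ 1`** (orientation-agnostic core of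
`isMinimal_of_door`, added at the 2026-08-17 migration): if the closed `4`-manifold `N` has
`rank H₂(N; ℤ) = 1` and `μ` is a `ℤ`-orientation with `b⁺(μ) ≥ 1`, its intersection form is
`Q(x, y) = e(x) e(y)` (`exists_linearEquiv_intersectionForm_of_door`), so `⟨σ ⌣ σ, [N]_μ⟩ = e(σ)² ≠ -1`
for every class `σ`. [cite: MilnorHusemoller1973, §I.2 and §V.1] -/
theorem not_sphere_sq_neg_one_of_door (μ : HomologicalOrientation ℤ N 4)
    (hpos : 1 ≤ sigPos (intersectionForm two_add_two_eq_four μ).toQuadraticMap)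
    (hb2 : Module.finrank ℤ (singularHomology ℤ ℤ N 2) = 1) (σ : singularCohomology ℤ ℤ N 2) :
    cupPairing μ two_add_two_eq_four σ σ ≠ -1 := by
  intro hm1
  obtain ⟨e, he⟩ := exists_linearEquiv_intersectionForm_of_door μ hpos hb2
  have hsq : cupPairing μ two_add_two_eq_four σ σ =
      e (freeCohomology.mk σ) * e (freeCohomology.mk σ) := by
    rw [← intersectionForm_mk_mk]; exact he _ _
  have h0 : (0 : ℤ) ≤ e (freeCohomology.mk σ) * e (freeCohomology.mk σ) := mul_self_nonneg _
  omega

-- `linter.deprecated` off for the next declaration only: its hypothesis `h1 : one_le_bPlus` is the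
-- fact deprecated AS A HYPOTHESIS (proved: `one_le_bPlus_holds`); the signature is ledger-referenced
-- (registered stub `stub_noGenusTwoDoor_of_gompfQuestion`, importer `GompfEulerCharacteristicQuestion.lean`).
set_option linter.deprecated false in
/-- **A door is minimal.** For a closed connected symplectic `(N, s)` with `rank H₂(N; ℤ) = 1`,
granted `b⁺ ≥ 1` for the symplectic orientation (`one_le_bPlus`, now the theorem
`one_le_bPlus_holds`), the intersection form of that orientation is `Q(x, y) = e(x) e(y)` in a
coordinate `e : H²(N; ℤ)/T ≃ ℤ` (`exists_linearEquiv_intersectionForm_of_door`), so every class has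
non-negative square and no symplectically embedded sphere has self-intersection `-1` (Liu 1996,
p. 579: "`b⁻ = 0` and hence minimal"; T.-J. Li 2015, §4.3.1).  Orientation-agnostic since the
2026-08-17 migration: the orientation read by `bPlus` and `IsSymplecticSphere` (the calibrated
symplectic orientation) is inferred by unification (`not_sphere_sq_neg_one_of_door`).
[cite: Liu1996, proof of Theorem B (pp. 578–579)] -/
theorem isMinimal_of_door (h1 : one_le_bPlus) (s : MForm (𝓡 4) N ℝ 2) (hs : IsSmoothForm s)
    (hcl : IsClosedForm s)
    (hnd : ∀ x (v : TangentSpace (𝓡 4) x), v ≠ 0 → ∃ w : TangentSpace (𝓡 4) x, s x ![v, w] ≠ 0)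
    (hb2 : Module.finrank ℤ (singularHomology ℤ ℤ N 2) = 1) : IsMinimal s hs hnd := by
  intro b hb
  obtain ⟨hemb, -, hself⟩ := hb
  -- the orientation read by `bPlus` / `IsSymplecticSphere` (since p160979: the calibrated symplectic
  -- orientation); `h1` supplies `b⁺ ≥ 1` for it by unification
  set μ : HomologicalOrientation ℤ N 4 := calibratedSymplecticOrientation s hs hnd with hμ
  have hpos : 1 ≤ sigPos (intersectionForm two_add_two_eq_four μ).toQuadraticMap := h1 N s hs hnd hcl
  -- an orientation of the `2`-sphere and the Poincaré dual of `b_*[𝕊²]`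
  obtain ⟨μS⟩ : IsOrientableOver ℤ (Metric.sphere (0 : EuclideanSpace ℝ (Fin 3)) 1) 2 :=
    Literature.Topology.FourManifolds.SphereProd.isOrientableOver_sphere (k := 2) le_rfl
  set D := poincareDualityEquiv μ two_add_two_eq_four (poincare_duality μ two_add_two_eq_four)
    with hD
  set c : singularHomology ℤ ℤ N 2 :=
    singularHomology.map ℤ ℤ ⟨b, hemb.isEmbedding.continuous⟩ 2 μS.fundamentalClass with hc
  have hPD : poincareDualityMap μ two_add_two_eq_four (D.symm c) = c := by
    rw [← poincareDualityEquiv_apply μ two_add_two_eq_four (poincare_duality μ _), ← hD]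
    exact D.apply_symm_apply c
  exact not_sphere_sq_neg_one_of_door μ hpos hb2 (D.symm c) (hself μS (D.symm c) hPD)

omit [T2Space N] [SecondCountableTopology N] [CompactSpace N] [ConnectedSpace N] [IsManifold (𝓡 4) ∞ N] in
/-- **A door is not `ℂP²`**: `H₁(ℂP²; ℤ) = 0` (Hatcher 2002, Thm. 2.35 (iii); the tree's proved
`singularHomology_complexProjectiveSpace_holds`) while a door has `rank H₁(N; ℤ) = 2`, and
singular homology is a homeomorphism invariant. [cite: HatcherAT2002, §2.2 Thm. 2.35 application (iii)] -/
theorem not_nonempty_diffeomorph_complexProjectivePlane_of_door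
    (hb1 : Module.finrank ℤ (singularHomology ℤ ℤ N 1) = 2) :
    ¬ Nonempty (N ≃ₘ⟮𝓡 4, 𝓡 4⟯ ComplexProjectivePlane) := by
  rintro ⟨φ⟩
  have hZ : IsZero (singularHomology ℤ ℤ (ComplexProjectiveSpace 2) 1) :=
    (Literature.Topology.FourManifolds.singularHomology_complexProjectiveSpace_holds 2 1).2
      (by decide)
  have hZN : IsZero (singularHomology ℤ ℤ N 1) :=
    IsZero.of_iso hZ (singularHomology.mapIso ℤ ℤ φ.toHomeomorph 1)
  have h0 : Module.finrank ℤ (singularHomology ℤ ℤ N 1) = 0 := finrank_eq_zero_of_isZero hZN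
  omega

-- `linter.deprecated` off for the next declaration only: it names the facts deprecated AS
-- HYPOTHESES `one_le_bPlus` / `liu1996_complexProjectivePlane_of_rank_two_eq_one` (ledger-referenced
-- signature: registered stub `stub_noGenusTwoDoor_of_gompfQuestion`; importer `GompfEulerCharacteristicQuestion.lean`).
set_option linter.deprecated false in
/-- **`K · [ω] ≥ 0` for a door**, from Liu's `b₂ = 1` theorem
(`liu1996_complexProjectivePlane_of_rank_two_eq_one`: a closed connected symplectic `(N, s)` with
`rank H₂(N; ℤ) = 1` and `K · [ω] < 0` is diffeomorphic to `ℂP²`) and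
`not_nonempty_diffeomorph_complexProjectivePlane_of_door`. [cite: Liu1996, proof of Theorem B (pp. 578–579)] -/
theorem canonicalClassDotOmega_nonneg_of_door (hL : liu1996_complexProjectivePlane_of_rank_two_eq_one)
    (s : MForm (𝓡 4) N ℝ 2) (hs : IsSmoothForm s) (hcl : IsClosedForm s)
    (hnd : ∀ x (v : TangentSpace (𝓡 4) x), v ≠ 0 → ∃ w : TangentSpace (𝓡 4) x, s x ![v, w] ≠ 0)
    (hb1 : Module.finrank ℤ (singularHomology ℤ ℤ N 1) = 2)
    (hb2 : Module.finrank ℤ (singularHomology ℤ ℤ N 2) = 1) :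
    0 ≤ canonicalClassDotOmega s hs hcl hnd :=
  (nonempty_diffeomorph_complexProjectivePlane_or_canonicalDotOmega_nonneg hL s hs hcl hnd hb2).resolve_left
    (not_nonempty_diffeomorph_complexProjectivePlane_of_door hb1)

omit [SecondCountableTopology N] in
/-- **The Euler characteristic of a door is `-1`** (`χ = 1 - 2 + 1 - 2 + 1`; the orientation
needed for `rank H₃ = rank H₁` is the constructive symplectic one). [cite: HatcherAT2002, §2.2 p. 146, Thm. 3.26 and Thm. 3.30] -/
theorem relEuler_eq_neg_one_of_door' (s : MForm (𝓡 4) N ℝ 2) (hs : IsSmoothForm s)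
    (hnd : ∀ x (v : TangentSpace (𝓡 4) x), v ≠ 0 → ∃ w : TangentSpace (𝓡 4) x, s x ![v, w] ≠ 0)
    (hb1 : Module.finrank ℤ (singularHomology ℤ ℤ N 1) = 2)
    (hb2 : Module.finrank ℤ (singularHomology ℤ ℤ N 2) = 1) :
    relEuler ℤ ℤ N ∅ = -1 :=
  relEuler_eq_neg_one_of_door (symplecticOrientation s hs hnd) hb1 hb2

end Door

-- `linter.deprecated` off for the next declaration only: it names the facts deprecated AS
-- HYPOTHESES `one_le_bPlus` / `liu1996_complexProjectivePlane_of_rank_two_eq_one` (ledger-referenced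
-- signature: registered stub `stub_noGenusTwoDoor_of_gompfQuestion`; importer `GompfEulerCharacteristicQuestion.lean`).
set_option linter.deprecated false in
/-- **Gompf's question (minimal, Kodaira form) implies `NoGenusTwoDoor`.**  If every closed
connected MINIMAL symplectic `4`-manifold `(N, s)` with `K · [ω] ≥ 0` — i.e. (Liu 1996 Thm. B,
Ohta–Ono 1996; McDuff–Salamon 2017 Rem. 13.3.28 (ii)) neither rational nor ruled — has
`χ(N) ≥ 0` (the affirmative answer to Gompf's 1995 question as recorded by Kotschick 2006, p. 3,
restricted to minimal manifolds; T.-J. Li 2015 §4.3.1, Conj. 4.9 / Conj. 4.11), then no door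
exists: a door is minimal (`isMinimal_of_door`), has `K · [ω] ≥ 0`
(`canonicalClassDotOmega_nonneg_of_door`) and `χ = -1`.  Conditional on exactly the two printed
named facts `one_le_bPlus` and `liu1996_complexProjectivePlane_of_rank_two_eq_one`; the
hypothesis `hG` is the registered open statement `GompfEulerCharacteristicQuestion` spelled out.
[cite: Liu1996, Theorem B and pp. 578–579] [cite: McDuffSalamon2017, Rem. 13.3.4; Rem. 13.3.28 (ii)] -/
theorem noGenusTwoDoor_of_eulerChar_nonneg
    (hG : ∀ (N : Type) [TopologicalSpace N] [T2Space N] [SecondCountableTopology N] [CompactSpace N]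
      [ConnectedSpace N] [ChartedSpace (EuclideanSpace ℝ (Fin 4)) N] [IsManifold (𝓡 4) ∞ N]
      (s : MForm (𝓡 4) N ℝ 2) (hs : IsSmoothForm s) (hcl : IsClosedForm s)
      (hnd : ∀ x (v : TangentSpace (𝓡 4) x), v ≠ 0 → ∃ w : TangentSpace (𝓡 4) x, s x ![v, w] ≠ 0),
      IsMinimal s hs hnd → 0 ≤ canonicalClassDotOmega s hs hcl hnd → 0 ≤ relEuler ℤ ℤ N ∅)
    (h1 : one_le_bPlus) (hL : liu1996_complexProjectivePlane_of_rank_two_eq_one) :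
    NoGenusTwoDoor := by
  intro N _ _ _ _ _ _ _ s hs hcl hnd hdoor
  obtain ⟨hb1, hb2⟩ := hdoor
  have hb1' : Module.finrank ℤ (singularHomology ℤ ℤ N 1) = 2 := hb1
  have hb2' : Module.finrank ℤ (singularHomology ℤ ℤ N 2) = 1 := hb2
  have hχ : relEuler ℤ ℤ N ∅ = -1 := relEuler_eq_neg_one_of_door' s hs hnd hb1' hb2'
  have h0 : 0 ≤ relEuler ℤ ℤ N ∅ :=
    hG N s hs hcl hnd (isMinimal_of_door h1 s hs hcl hnd hb2')
      (canonicalClassDotOmega_nonneg_of_door hL s hs hcl hnd hb1' hb2')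
  omega

-- `linter.deprecated` off for the next declaration only: it names the facts deprecated AS
-- HYPOTHESES `one_le_bPlus` / `liu1996_complexProjectivePlane_of_rank_two_eq_one` (ledger-referenced
-- signature: registered stub `stub_noGenusTwoDoor_of_gompfQuestion`; importer `GompfEulerCharacteristicQuestion.lean`).
set_option linter.deprecated false in
/-- **Registered sub-goal `stub_noGenusTwoDoor_of_gompfQuestion` of the crux item** (one-line
form of `noGenusTwoDoor_of_eulerChar_nonneg`): Gompf's question in minimal Kodaira form, then
`one_le_bPlus`, then `liu1996_complexProjectivePlane_of_rank_two_eq_one`, imply `NoGenusTwoDoor`.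
[cite: Liu1996, Theorem B and pp. 578–579] [cite: McDuffSalamon2017, Rem. 13.3.4; Rem. 13.3.28 (ii)] -/
theorem stub_noGenusTwoDoor_of_gompfQuestion : (∀ (N : Type) [TopologicalSpace N] [T2Space N] [SecondCountableTopology N] [CompactSpace N] [ConnectedSpace N] [ChartedSpace (EuclideanSpace ℝ (Fin 4)) N] [IsManifold (𝓡 4) ∞ N] (s : Literature.Geometry.Kaehler.MForm (𝓡 4) N ℝ 2) (hs : Literature.Geometry.Kaehler.IsSmoothForm s) (hcl : Literature.Geometry.Kaehler.IsClosedForm s) (hnd : ∀ x (v : TangentSpace (𝓡 4) x), v ≠ 0 → ∃ w : TangentSpace (𝓡 4) x, s x ![v, w] ≠ 0), Literature.Geometry.Symplectic.IsMinimal s hs hnd → 0 ≤ Literature.Geometry.Symplectic.canonicalClassDotOmega s hs hcl hnd → 0 ≤ Literature.AlgebraicTopology.SingularHomology.relEuler ℤ ℤ N ∅) → Literature.Geometry.Symplectic.one_le_bPlus → Literature.Geometry.Symplectic.liu1996_complexProjectivePlane_of_rank_two_eq_one → Summit.SmoothPoincare4.SmoothPoincare4.Theses.SymplecticOrigami.NoGenusTwoDoor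 :=
  fun hG h1 hL => noGenusTwoDoor_of_eulerChar_nonneg hG h1 hL

/-- **Registered sub-goal `stub_not_sphere_sq_neg_one_of_door` of the crux item** (one-line form of
`not_sphere_sq_neg_one_of_door`, the orientation-agnostic core of `isMinimal_of_door` added at the
2026-08-17 migration): on a closed `4`-manifold with `rank H₂ = 1`, no class has square `-1` for an
orientation with `b⁺ ≥ 1`. [cite: MilnorHusemoller1973, §I.2 and §V.1] -/
theorem stub_not_sphere_sq_neg_one_of_door : ∀ (N : Type) [TopologicalSpace N] [T2Space N] [CompactSpace N] [ChartedSpace (EuclideanSpace ℝ (Fin 4)) N] (μ : Literature.AlgebraicTopology.SingularHomology.HomologicalOrientation ℤ N 4), 1 ≤ sigPos (Literature.AlgebraicTopology.SingularHomology.intersectionForm two_add_two_eq_four μ).toQuadraticMap → Module.finrank ℤ (Literature.AlgebraicTopology.SingularHomology.singularHomology ℤ ℤ N 2) = 1 → ∀ σ : Literature.AlgebraicTopology.SingularHomology.singularCohomology ℤ ℤ N 2, Literature.AlgebraicTopology.SingularHomology.cupPairing μ two_add_two_eq_four σ σ ≠ -1 :=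
  fun _ _ _ _ _ μ hpos hb2 σ => not_sphere_sq_neg_one_of_door μ hpos hb2 σ

end Summit.SmoothPoincare4.SmoothPoincare4.Theorems.NoGenusTwoDoor.GompfBridge

end
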